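import Mathlib.Analysis.BoxIntegral.UnitPartition
import HarnessLib

/-!
# Lattice points of a coset `v + mℤⁿ` in an expanding Jordan-measurable region (main term)

Topic `Literature/Algebra/EuclideanLattices` (geometry of numbers); companion of
`LatticePointCounting.lean` (Marcus's cell counting, with an `O(t^{n−1})` error under a
Lipschitz-parametrizable frontier) under the WEAKER hypothesis that the frontier is Lebesgue-null,
giving the main term only, but for TRANSLATES of the integer lattice — the input shape of
Davenport's theorem with congruence conditions (Bhargava–Shankar–Tsimerman 2013, §5.5, proof of
Thm. 20: "`S` may be viewed as the intersection of `V^{(i)}` with the union of `k` translates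
`L_1, …, L_k` of the lattice `m · V_ℤ`, … where each `d`-dimensional volume is scaled by a factor of
`1/m^d` to reflect the fact that our new lattice has been scaled by a factor of `m`").

Everything here is PROVED; the mechanism is Mathlib's (`BoxIntegral.unitPartition`,
`tendsto_card_div_pow_atTop_volume`: the lattice-point count is a Riemann sum of the indicator of
`s`, which is Riemann integrable because it is a.e. continuous), with the tags of the unit
partition moved from the upper corners `(ν + 1)/n` to arbitrary points `(ν + θ)/n`, `θ ∈ (0,1]ⁿ`:
* `shiftTag n θ ν = (ν + θ)/n`, `shiftPrepartition` (the unit prepartition with shifted tags;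
  Henstock, subordinate to `1/n`, a partition of a box with integral vertices), `integralSum_shift_eq`;
* **`tendsto_card_shift_div_pow`** — for `s ⊆ ℝⁿ` bounded, measurable, with `vol(frontier s) = 0`
  and ANY shifts `θ_k ∈ (0,1]ⁿ`: `#{ν ∈ ℤⁿ : (ν + θ_k)/k ∈ s} / kⁿ → vol(s)` (`k → ∞` in `ℕ`);
* **`tendsto_card_coset_div_pow`** — for `s` moreover star-shaped about `0`, `m ≥ 1`, `v ∈ ℤⁿ`:
  `#{y ∈ ℤⁿ : v + m y ∈ t • s} / tⁿ → vol(s)/mⁿ` as `t → ∞` in `ℝ` (integer heights by the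
  previous theorem with `θ = the fractional position of v/m`; real heights by monotonicity).

## References

* M. Bhargava, A. Shankar, J. Tsimerman, *On the Davenport–Heilbronn theorems and second order
  terms*, Invent. Math. 193 (2013) 439–499 = arXiv:1005.0672, §5.5 (Thm. 20) [BhargavaShankarTsimerman2012].
* H. Davenport, *On a principle of Lipschitz*, J. London Math. Soc. 26 (1951) 179–183 [Davenport1951].
-/

noncomputable section

open Filter MeasureTheory Bornology BoxIntegral BoxIntegral.unitPartition
open scoped Topology Pointwise

namespace Literature.Algebra.EuclideanLattices

variable {ι : Type*}

/-! ### The unit prepartition with shifted tags -/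

section Shift

variable (n : ℕ)

/-- The shifted tag `(ν + θ)/n` of the box of index `ν` at scale `n`. [folklore] -/
def shiftTag (θ : ι → ℝ) (ν : ι → ℤ) : ι → ℝ := fun i => ((ν i : ℝ) + θ i) / n

/-- `shiftTag` coordinatewise (definitional). [folklore] -/
@[simp] theorem shiftTag_apply (θ : ι → ℝ) (ν : ι → ℤ) (i : ι) : shiftTag n θ ν i = ((ν i : ℝ) + θ i) / n := rfl

variable [NeZero n] {θ : ι → ℝ} (hθ : ∀ i, θ i ∈ Set.Ioc (0 : ℝ) 1)
include hθ

/-- For `θ ∈ (0, 1]ⁿ` the shifted tag lies in its (half-open) box. [folklore] -/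
theorem shiftTag_mem_box (ν : ι → ℤ) : shiftTag n θ ν ∈ box n ν := by
  have hn : (0 : ℝ) < n := Nat.cast_pos.mpr n.pos_of_neZero
  refine mem_box_iff.mpr fun i => ⟨?_, ?_⟩
  · rw [shiftTag_apply]
    exact div_lt_div_of_pos_right (by linarith [(hθ i).1]) hn
  · rw [shiftTag_apply]
    exact div_le_div_of_nonneg_right (by linarith [(hθ i).2]) hn.le

/-- Hence its index is `ν`. [folklore] -/
theorem index_shiftTag (ν : ι → ℤ) : index n (shiftTag n θ ν) = ν :=
  mem_box_iff_index.mp (shiftTag_mem_box n hθ ν)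

/-- `ν ↦ shiftTag n θ ν` is injective. [folklore] -/
theorem shiftTag_injective : Function.Injective (shiftTag n θ) := fun ν ν' h => by
  rw [← index_shiftTag n hθ ν, ← index_shiftTag n hθ ν', h]

variable [Fintype ι]

open scoped Classical in
/-- **The unit prepartition of `B` at scale `n` with shifted tags `(ν + θ)/n`** (same boxes as
Mathlib's `BoxIntegral.unitPartition.prepartition n B`). [folklore] -/
def shiftPrepartition (B : Box ι) : TaggedPrepartition B where
  toPrepartition := (prepartition n B).toPrepartition
  tag I := if hI : ∃ ν ∈ admissibleIndex n B, I = box n ν then shiftTag n θ hI.choose else B.exists_mem.choose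
  tag_mem_Icc I := by
    by_cases hI : ∃ ν ∈ admissibleIndex n B, I = box n ν
    · simp_rw [dif_pos hI]
      exact Box.coe_subset_Icc <| (mem_admissibleIndex_iff.mp hI.choose_spec.1) (shiftTag_mem_box n hθ _)
    · simp_rw [dif_neg hI]
      exact Box.coe_subset_Icc B.exists_mem.choose_spec

/-- The boxes of the shifted prepartition are the unit boxes of admissible index. [folklore] -/
theorem mem_shiftPrepartition_iff {B I : Box ι} :
    I ∈ shiftPrepartition n hθ B ↔ ∃ ν ∈ admissibleIndex n B, box n ν = I := by
  rw [← mem_prepartition_iff (n := n)]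
  rfl

/-- The tag of the box of index `ν` is `(ν + θ)/n`. [folklore] -/
theorem shiftPrepartition_tag {ν : ι → ℤ} {B : Box ι} (hν : ν ∈ admissibleIndex n B) :
    (shiftPrepartition n hθ B).tag (box n ν) = shiftTag n θ ν := by
  dsimp only [shiftPrepartition]
  have h : ∃ ν' ∈ admissibleIndex n B, box n ν = box n ν' := ⟨ν, hν, rfl⟩
  rw [dif_pos h, (shiftTag_injective n hθ).eq_iff, ← (box_injective n).eq_iff]
  exact h.choose_spec.2.symm

/-- The shifted prepartition is Henstock (tags in the closed boxes). [folklore] -/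
theorem shiftPrepartition_isHenstock (B : Box ι) : (shiftPrepartition n hθ B).IsHenstock := by
  intro I hI
  obtain ⟨ν, hν, rfl⟩ := (mem_shiftPrepartition_iff n hθ).mp hI
  rw [shiftPrepartition_tag n hθ hν]
  exact Box.coe_subset_Icc (shiftTag_mem_box n hθ _)

/-- The shifted prepartition is subordinate to any constant `r ≥ 1/n`. [folklore] -/
theorem shiftPrepartition_isSubordinate (B : Box ι) {r : ℝ} (hr : 0 < r) (hn : 1 / n ≤ r) :
    (shiftPrepartition n hθ B).IsSubordinate (fun _ => ⟨r, hr⟩) := by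
  intro I hI
  obtain ⟨ν, hν, rfl⟩ := (mem_shiftPrepartition_iff n hθ).mp hI
  refine fun x h => le_trans (Metric.dist_le_diam_of_mem (Box.isBounded_Icc _) h ?_) ?_
  · rw [shiftPrepartition_tag n hθ hν]
    exact Box.coe_subset_Icc (shiftTag_mem_box n hθ _)
  · exact le_trans (diam_boxIcc n ν) hn

/-- It is a partition of a box with integral vertices. [folklore] -/
theorem shiftPrepartition_isPartition {B : Box ι} (hB : hasIntegralVertices B) :
    (shiftPrepartition n hθ B).IsPartition :=
  prepartition_isPartition n hB

/-- **The Riemann sum of an indicator over the shifted prepartition is a lattice-point count**: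
`Σ_I vol(I) · 𝟙_s(tag I) = #{ν ∈ ℤⁿ : (ν + θ)/n ∈ s} / nⁿ` for `s ⊆ B`, `B` with integral vertices.
[folklore] -/
theorem integralSum_shift_eq {B : Box ι} (hB : hasIntegralVertices B) {s : Set (ι → ℝ)} (hs₀ : s ≤ B)
    (hfin : {ν : ι → ℤ | shiftTag n θ ν ∈ s}.Finite) :
    integralSum (s.indicator fun _ => (1 : ℝ)) (BoxAdditiveMap.toSMul (Measure.toBoxAdditive volume))
      (shiftPrepartition n hθ B) = (Nat.card {ν : ι → ℤ | shiftTag n θ ν ∈ s} : ℝ) / n ^ Fintype.card ι := by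
  classical
  unfold integralSum
  have hboxes : (shiftPrepartition n hθ B).boxes = Finset.image (fun ν => box n ν) (admissibleIndex n B) := rfl
  rw [hboxes, Finset.sum_image fun ν _ ν' _ h => box_injective n h]
  simp_rw [BoxAdditiveMap.toSMul_apply, Measure.toBoxAdditive_apply, smul_eq_mul, Set.indicator_apply,
    mul_ite, mul_one, mul_zero]
  rw [Finset.sum_ite, Finset.sum_const_zero, add_zero, Finset.sum_congr rfl fun ν _ => by
    rw [measureReal_def, volume_box, ENNReal.toReal_div, ENNReal.toReal_one, ENNReal.toReal_pow,
      ENNReal.toReal_natCast]]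
  rw [Finset.sum_const, nsmul_eq_mul, mul_one_div]
  congr 1
  rw [Nat.card_eq_card_finite_toFinset hfin]
  congr 1
  refine congrArg Finset.card (Finset.ext fun ν => ?_)
  simp only [Finset.mem_filter, Set.Finite.mem_toFinset, Set.mem_setOf_eq]
  constructor
  · rintro ⟨hν, h⟩
    rwa [shiftPrepartition_tag n hθ hν] at h
  · intro h
    have hν : ν ∈ admissibleIndex n B := by
      simpa [index_shiftTag n hθ] using mem_admissibleIndex_of_mem_box n hB (hs₀ h)
    exact ⟨hν, by rwa [shiftPrepartition_tag n hθ hν]⟩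

end Shift

/-! ### Shifted lattice points in a Jordan-measurable set -/

section Count

variable [Fintype ι]

/-- For `s` bounded, the shifted lattice points `(ν + θ)/n ∈ s` are finitely many. [folklore] -/
theorem finite_setOf_shiftTag_mem {s : Set (ι → ℝ)} (hs : IsBounded s) (n : ℕ) [NeZero n] (θ : ι → ℝ) :
    {ν : ι → ℤ | shiftTag n θ ν ∈ s}.Finite := by
  obtain ⟨R, hR⟩ := hs.subset_closedBall 0
  have hn : (0 : ℝ) < n := Nat.cast_pos.mpr n.pos_of_neZero
  -- each coordinate of such a `ν` is confined to a bounded interval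
  have hsub : {ν : ι → ℤ | shiftTag n θ ν ∈ s} ⊆
      Set.pi Set.univ fun i => Set.Icc (⌊-(n * R) - θ i⌋) (⌈n * R - θ i⌉) := by
    intro ν hν i _
    have h := hR hν
    rw [Metric.mem_closedBall, dist_zero_right, pi_norm_le_iff_of_nonneg (le_trans dist_nonneg (hR hν))] at h
    have hi := h i
    rw [shiftTag_apply, Real.norm_eq_abs, abs_le, le_div_iff₀ hn, div_le_iff₀ hn] at hi
    refine ⟨Int.floor_le_iff.mpr ?_, Int.le_ceil_iff.mpr ?_⟩ <;> nlinarith [hi.1, hi.2]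
  exact (Set.Finite.pi fun i => Set.finite_Icc _ _).subset hsub

/-- **Shifted lattice points in a Jordan-measurable set.** Let `s ⊆ ℝⁿ` be bounded and measurable
with `vol(frontier s) = 0`, and let `θ_k ∈ (0, 1]ⁿ` be arbitrary shifts. Then
`#{ν ∈ ℤⁿ : (ν + θ_k)/k ∈ s} / kⁿ → vol(s)` as `k → ∞` (the count is a Riemann sum of `𝟙_s` for the
unit partition at scale `k` with tags `(ν + θ_k)/k`, and `𝟙_s` is Riemann integrable, being a.e.
continuous; compare Mathlib's `tendsto_card_div_pow_atTop_volume`, the case `θ = 1`). [folklore] -/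
theorem tendsto_card_shift_div_pow (s : Set (ι → ℝ)) (hs₁ : IsBounded s) (hs₂ : MeasurableSet s)
    (hs₃ : volume (frontier s) = 0) (θ : ℕ → ι → ℝ) (hθ : ∀ k i, θ k i ∈ Set.Ioc (0 : ℝ) 1) :
    Tendsto (fun k : ℕ => (Nat.card {ν : ι → ℤ | shiftTag k (θ k) ν ∈ s} : ℝ) / k ^ Fintype.card ι)
      atTop (𝓝 (volume.real s)) := by
  obtain ⟨B, hB, hs₀⟩ := le_hasIntegralVertices_of_isBounded hs₁
  set F : (ι → ℝ) → ℝ := s.indicator fun _ => 1 with hF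
  refine Metric.tendsto_atTop.mpr fun ε hε => ?_
  have h₁ : ∃ C, ∀ x ∈ Box.Icc B, ‖F x‖ ≤ C :=
    ⟨1, fun x _ => (norm_indicator_le_norm_self _ _).trans (by simp)⟩
  have h₂ : ∀ᵐ x, ContinuousAt F x := by
    filter_upwards [compl_mem_ae_iff.mpr hs₃] with _ h
      using (continuous_const (y := (1 : ℝ))).continuousOn.continuousAt_indicator h
  obtain ⟨r, hr₁, hr₂⟩ := (hasIntegral_iff.mp <|
      AEContinuous.hasBoxIntegral (volume : Measure (ι → ℝ)) h₁ h₂ IntegrationParams.Riemann) (ε / 2) (half_pos hε)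
  refine ⟨⌈(r 0 0 : ℝ)⁻¹⌉₊, fun k hk => lt_of_le_of_lt ?_ (half_lt_self_iff.mpr hε)⟩
  have : NeZero k :=
    ⟨Nat.ne_zero_iff_zero_lt.mpr <| (Nat.ceil_pos.mpr (inv_pos.mpr (r 0 0).prop)).trans_le hk⟩
  have hint : ∫ x in (B : Set (ι → ℝ)), F x = volume.real s := by
    rw [hF, integral_indicator hs₂, Measure.restrict_restrict_of_subset hs₀, setIntegral_const, smul_eq_mul, mul_one]
  rw [← integralSum_shift_eq k (hθ k) hB hs₀ (finite_setOf_shiftTag_mem hs₁ k (θ k)), ← hint]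
  refine hr₂ 0 _ ⟨?_, fun _ => ?_, fun h => ?_, fun h => ?_⟩ (shiftPrepartition_isPartition k (hθ k) hB)
  · rw [show r 0 = fun _ => r 0 0 from funext_iff.mpr (hr₁ 0 rfl)]
    apply shiftPrepartition_isSubordinate k (hθ k) B
    rw [one_div, inv_le_comm₀ (mod_cast (Nat.pos_of_neZero k)) (r 0 0).prop]
    exact le_trans (Nat.le_ceil _) (Nat.cast_le.mpr hk)
  · exact shiftPrepartition_isHenstock k (hθ k) B
  · simp only [IntegrationParams.Riemann, Bool.false_eq_true] at h
  · simp only [IntegrationParams.Riemann, Bool.false_eq_true] at h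

end Count

/-! ### Cosets `v + mℤⁿ` in `t • s`, real `t → ∞` -/

section Star

variable {s : Set (ι → ℝ)}

/-- Star-shapedness about `0` makes `u ↦ u • s` monotone on `u > 0`. [folklore] -/
theorem smul_subset_smul_of_le (hs : ∀ ⦃x : ι → ℝ⦄, x ∈ s → ∀ ⦃a : ℝ⦄, 0 ≤ a → a ≤ 1 → a • x ∈ s)
    {u u' : ℝ} (hu : 0 < u) (huu' : u ≤ u') : u • s ⊆ u' • s := by
  rintro _ ⟨x, hx, rfl⟩
  have hu' : 0 < u' := hu.trans_le huu'
  refine ⟨(u / u') • x, hs hx (div_nonneg hu.le hu'.le) ((div_le_one hu').mpr huu'), ?_⟩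
  simp only [smul_smul]
  rw [mul_div_cancel₀ _ hu'.ne']

end Star

section Coset

variable [Fintype ι]

omit [Fintype ι] in
/-- The count of `y ∈ ℤⁿ` with `y + w ∈ u • s`, for a fixed real shift `w`, as a shifted-tag count at
integer height `u = k`: write `w = κ + θ` with `κ ∈ ℤⁿ`, `θ ∈ (0,1]ⁿ`. [folklore] -/
theorem card_add_mem_smul_eq (s : Set (ι → ℝ)) (w : ι → ℝ) (k : ℕ) [NeZero k] :
    Nat.card {y : ι → ℤ | (fun i => (y i : ℝ) + w i) ∈ (k : ℝ) • s} =
      Nat.card {ν : ι → ℤ | shiftTag k (fun i => w i - (⌈w i⌉ - 1 : ℤ)) ν ∈ s} := by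
  have hk : (k : ℝ) ≠ 0 := Nat.cast_ne_zero.mpr (NeZero.ne k)
  refine Nat.card_congr (Equiv.subtypeEquiv (Equiv.addRight fun i => (⌈w i⌉ - 1 : ℤ)) fun y => ?_)
  simp only [Set.mem_setOf_eq, Equiv.coe_addRight, Set.mem_smul_set_iff_inv_smul_mem₀ hk]
  refine iff_of_eq (congrArg (· ∈ s) (funext fun i => ?_))
  simp only [Pi.smul_apply, smul_eq_mul, shiftTag_apply, Pi.add_apply, Int.cast_add, Int.cast_sub, Int.cast_one]
  ring

/-- The fractional shifts `w_i − (⌈w_i⌉ − 1)` lie in `(0, 1]`. [folklore] -/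
theorem sub_ceil_sub_one_mem_Ioc (x : ℝ) : x - (⌈x⌉ - 1 : ℤ) ∈ Set.Ioc (0 : ℝ) 1 := by
  have h1 := Int.ceil_lt_add_one x
  have h2 := Int.le_ceil x
  push_cast
  constructor <;> linarith

/-- **Integer heights**: for a fixed shift `w ∈ ℝⁿ`, `#{y ∈ ℤⁿ : y + w ∈ k • s}/kⁿ → vol(s)`. [folklore] -/
theorem tendsto_card_add_mem_smul_div_pow (s : Set (ι → ℝ)) (hs₁ : IsBounded s) (hs₂ : MeasurableSet s)
    (hs₃ : volume (frontier s) = 0) (w : ι → ℝ) :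
    Tendsto (fun k : ℕ => (Nat.card {y : ι → ℤ | (fun i => (y i : ℝ) + w i) ∈ (k : ℝ) • s} : ℝ) / k ^ Fintype.card ι)
      atTop (𝓝 (volume.real s)) := by
  have h := tendsto_card_shift_div_pow s hs₁ hs₂ hs₃ (fun _ i => w i - (⌈w i⌉ - 1 : ℤ))
    (fun _ i => sub_ceil_sub_one_mem_Ioc (w i))
  refine h.congr' ?_
  filter_upwards [eventually_gt_atTop 0] with k hk
  haveI : NeZero k := ⟨hk.ne'⟩
  rw [card_add_mem_smul_eq]

variable {s : Set (ι → ℝ)}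

/-- Monotonicity of the shifted count in the height. [folklore] -/
theorem card_add_mem_smul_mono (hs₁ : IsBounded s)
    (hs : ∀ ⦃x : ι → ℝ⦄, x ∈ s → ∀ ⦃a : ℝ⦄, 0 ≤ a → a ≤ 1 → a • x ∈ s) (w : ι → ℝ) {u u' : ℝ} (hu : 0 < u)
    (huu' : u ≤ u') :
    Nat.card {y : ι → ℤ | (fun i => (y i : ℝ) + w i) ∈ u • s} ≤
      Nat.card {y : ι → ℤ | (fun i => (y i : ℝ) + w i) ∈ u' • s} := by
  refine Nat.card_mono ?_ fun y hy => smul_subset_smul_of_le hs hu huu' hy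
  -- finiteness of the larger set: it embeds into the bounded set `u' • s - w`
  have hb : IsBounded (u' • s) := hs₁.smul₀ u'
  obtain ⟨R, hR⟩ := hb.subset_closedBall 0
  have hsub : {y : ι → ℤ | (fun i => (y i : ℝ) + w i) ∈ u' • s} ⊆
      Set.pi Set.univ fun i => Set.Icc (⌊-R - w i⌋) (⌈R - w i⌉) := by
    intro y hy i _
    have h := hR hy
    rw [Metric.mem_closedBall, dist_zero_right, pi_norm_le_iff_of_nonneg (le_trans dist_nonneg (hR hy))] at h
    have hi := h i
    rw [Real.norm_eq_abs, abs_le] at hi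
    refine ⟨Int.floor_le_iff.mpr ?_, Int.le_ceil_iff.mpr ?_⟩ <;> linarith [hi.1, hi.2]
  exact (Set.Finite.pi fun i => Set.finite_Icc _ _).subset hsub

/-- **Lattice points of a coset in an expanding star-shaped Jordan-measurable region.** Let
`s ⊆ ℝⁿ` be bounded, measurable, star-shaped about `0`, with `vol(frontier s) = 0`; let `m ≥ 1` and
`v ∈ ℤⁿ`. Then `#{y ∈ ℤⁿ : v + m·y ∈ t • s} / tⁿ → vol(s)/mⁿ` as `t → ∞` — equivalently, the points
of the coset `v + mℤⁿ` in `t • s` number `vol(s) tⁿ/mⁿ + o(tⁿ)` (the main term of Davenport's lemma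
for the translates `L_j` of `m·V_ℤ` in BST's proof of Thm. 20). [cite: BhargavaShankarTsimerman2012, §5.5 (proof of Thm. 20: the translates L_j of m·V_ℤ, volumes scaled by 1/m^d)] -/
theorem tendsto_card_coset_div_pow (hs₁ : IsBounded s) (hs₂ : MeasurableSet s) (hs₃ : volume (frontier s) = 0)
    (hs : ∀ ⦃x : ι → ℝ⦄, x ∈ s → ∀ ⦃a : ℝ⦄, 0 ≤ a → a ≤ 1 → a • x ∈ s) {m : ℕ} (hm : 0 < m) (v : ι → ℤ) :
    Tendsto (fun t : ℝ => (Nat.card {y : ι → ℤ | (fun i => (v i : ℝ) + m * y i) ∈ t • s} : ℝ) / t ^ Fintype.card ι)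
      atTop (𝓝 (volume.real s / (m : ℝ) ^ Fintype.card ι)) := by
  set d := Fintype.card ι with hd
  set w : ι → ℝ := fun i => (v i : ℝ) / m with hw
  have hm0 : (0 : ℝ) < m := Nat.cast_pos.mpr hm
  -- the count at real height `t` is the shifted count at height `t/m`
  set N : ℝ → ℕ := fun u => Nat.card {y : ι → ℤ | (fun i => (y i : ℝ) + w i) ∈ u • s} with hN
  have hcount : ∀ t : ℝ, 0 < t →
      Nat.card {y : ι → ℤ | (fun i => (v i : ℝ) + m * y i) ∈ t • s} = N (t / m) := by
    intro t ht
    refine Nat.card_congr (Equiv.subtypeEquivRight fun y => ?_)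
    simp only [Set.mem_setOf_eq, Set.mem_smul_set_iff_inv_smul_mem₀ ht.ne',
      Set.mem_smul_set_iff_inv_smul_mem₀ (div_pos ht hm0).ne']
    refine iff_of_eq (congrArg (· ∈ s) (funext fun i => ?_))
    simp only [Pi.smul_apply, smul_eq_mul, hw]
    field_simp
    ring
  -- integer heights
  have hint : Tendsto (fun k : ℕ => (N k : ℝ) / k ^ d) atTop (𝓝 (volume.real s)) :=
    tendsto_card_add_mem_smul_div_pow s hs₁ hs₂ hs₃ w
  -- sandwich between the heights `⌊t/m⌋₊` and `⌈t/m⌉₊`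
  have hmono : ∀ {u u' : ℝ}, 0 < u → u ≤ u' → N u ≤ N u' := fun hu huu' =>
    card_add_mem_smul_mono hs₁ hs w hu huu'
  have hlow : ∀ᶠ t : ℝ in atTop, (N ⌊t / m⌋₊ : ℝ) / ⌊t / m⌋₊ ^ d * ((⌊t / m⌋₊ : ℝ) / t) ^ d ≤
      (Nat.card {y : ι → ℤ | (fun i => (v i : ℝ) + m * y i) ∈ t • s} : ℝ) / t ^ d := by
    filter_upwards [eventually_ge_atTop (m : ℝ)] with t ht
    have ht0 : 0 < t := hm0.trans_le ht
    have hfl : 0 < ⌊t / m⌋₊ := Nat.floor_pos.mpr ((one_le_div hm0).mpr ht)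
    rw [div_pow, mul_div, div_mul_cancel₀ _ (by positivity), hcount t ht0]
    gcongr
    exact hmono (Nat.cast_pos.mpr hfl) (Nat.floor_le (div_nonneg ht0.le hm0.le))
  have hupp : ∀ᶠ t : ℝ in atTop, (Nat.card {y : ι → ℤ | (fun i => (v i : ℝ) + m * y i) ∈ t • s} : ℝ) / t ^ d ≤
      (N ⌈t / m⌉₊ : ℝ) / ⌈t / m⌉₊ ^ d * ((⌈t / m⌉₊ : ℝ) / t) ^ d := by
    filter_upwards [eventually_gt_atTop (0 : ℝ)] with t ht0
    have hce : 0 < ⌈t / m⌉₊ := Nat.ceil_pos.mpr (div_pos ht0 hm0)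
    rw [div_pow, mul_div, div_mul_cancel₀ _ (by positivity), hcount t ht0]
    gcongr
    exact hmono (div_pos ht0 hm0) (Nat.le_ceil _)
  have hlim : volume.real s / (m : ℝ) ^ d = volume.real s * (1 / m) ^ d := by
    rw [one_div, inv_pow, div_eq_mul_inv]
  rw [hlim]
  have hfloor : Tendsto (fun t : ℝ => ((⌊t / m⌋₊ : ℝ) / t)) atTop (𝓝 (1 / m)) := by
    have h1 : Tendsto (fun t : ℝ => (⌊t / m⌋₊ : ℝ) / (t / m)) atTop (𝓝 1) :=
      tendsto_nat_floor_div_atTop.comp (tendsto_id.atTop_div_const hm0)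
    have h2 : Tendsto (fun t : ℝ => (⌊t / m⌋₊ : ℝ) / (t / m) * (1 / m)) atTop (𝓝 (1 * (1 / m))) :=
      h1.mul tendsto_const_nhds
    rw [one_mul] at h2
    refine h2.congr' ?_
    filter_upwards [eventually_gt_atTop (0 : ℝ)] with t ht
    field_simp
  have hceil : Tendsto (fun t : ℝ => ((⌈t / m⌉₊ : ℝ) / t)) atTop (𝓝 (1 / m)) := by
    have h1 : Tendsto (fun t : ℝ => (⌈t / m⌉₊ : ℝ) / (t / m)) atTop (𝓝 1) :=
      tendsto_nat_ceil_div_atTop.comp (tendsto_id.atTop_div_const hm0)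
    have h2 : Tendsto (fun t : ℝ => (⌈t / m⌉₊ : ℝ) / (t / m) * (1 / m)) atTop (𝓝 (1 * (1 / m))) :=
      h1.mul tendsto_const_nhds
    rw [one_mul] at h2
    refine h2.congr' ?_
    filter_upwards [eventually_gt_atTop (0 : ℝ)] with t ht
    field_simp
  have hfl_at : Tendsto (fun t : ℝ => ⌊t / m⌋₊) atTop atTop :=
    tendsto_nat_floor_atTop.comp (tendsto_id.atTop_div_const hm0)
  have hce_at : Tendsto (fun t : ℝ => ⌈t / m⌉₊) atTop atTop :=
    tendsto_nat_ceil_atTop.comp (tendsto_id.atTop_div_const hm0)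
  refine tendsto_of_tendsto_of_tendsto_of_le_of_le' ?_ ?_ hlow hupp
  · exact (hint.comp hfl_at).mul (hfloor.pow d)
  · exact (hint.comp hce_at).mul (hceil.pow d)

end Coset

end Literature.Algebra.EuclideanLattices

end
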